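import Summits.HodgeConjecture.CorCM.IrreducibleOddWeightsShadowModulesCMFields
import Summits.HodgeConjecture.CorCM.IrreducibleOddWeightsShadowIdealsSameField
import Summits.HodgeConjecture.CorCM.IrreducibleOddWeightsProductSpanConverse
import HarnessLib

/-!
# Shadow modules, IV (CM fields): TYPE-FREE ADDITIVITY over (IRR) pivots of DIFFERENT DEGREES, and the Hodge side —
# `Hg(A₀ × A₁) = Hg(A₀) × Hg(A₁)` for all CM types, no mixed Hodge classes, HC for nondegenerate realisations

COR-CM (cell `pub-hodgecm2`, binder seat `b16` gen 69, count-neutral claim ROW SPACES OVER THE COMMUTANT, file Q5 — CM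
fields; theorems only, no definition, no named fact, no `sorry`).  NEW as stated, hence under `Summits/`.  HONEST
FRAMING: a corollary of file Q4's interaction criterion (an interacting pair over (IRR) pivots forces an `Aut(ℂ)`-isomorphism
`Anti(T₁) ≅ Anti(T₀)`, hence `[T₀:ℚ] = [T₁:ℚ]`) combined with the tree's Moonen–Zarhin ∕ Pohlmann–Gordon theorems for
additive and nondegenerate families; the Hodge conjecture is obtained ONLY for the named nondegenerate products, from the
tree's unconditional theorem for nondegenerate families; `HC_CM` is neither used nor asserted.

SETTING (Q4).  CM fields `K_{i₀} ⊇ T₀`, `K_{i₁} ⊇ T₁`, the CM subfields `T_κ` containing the traces (TR) — e.g.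
`T_κ = K_{i_κ}` — with IRREDUCIBLE odd weights `Anti(T_κ)` ((IRR), gen 55: every (SC) field, every (M1) field, …).

* **`cmFamilyRank_add_card_eq_of_irreducible_of_finrank_ne`**: `[T₀:ℚ] ≠ [T₁:ℚ]` ⟹
  **`Hg(A₀ × A₁) = Hg(A₀) × Hg(A₁)` for EVERY pair of CM types** of `K_{i₀}`, `K_{i₁}` — in particular two (IRR) CM fields
  of different degrees never interact, whatever the types, and neither do any CM fields containing them as pivots with
  (TR) (all disjoint inflations, gen 68).  Compare gen 65/67 (real or odd traces): here the traces may be the CM fields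
  `T_κ` themselves.
* Hodge side: `forall_hodgeClassesProductSpan_of_irreducible_of_finrank_ne` (every rational Hodge class on every
  `A₀^a × A₁^b` is a `ℂ`-combination of exterior products), `isNondegenerateFamily_iff_of_irreducible_of_finrank_ne`
  (the pair is stably nondegenerate iff both types are nondegenerate), and
  **`hodgeConjectureFor_prod_of_irreducible_of_finrank_ne`**: for NONDEGENERATE `Φ₀, Φ₁` (automatic when
  `T_κ = K_{i_κ}` is (IRR), gen 55 `isNondegenerate_of_irreducible`) every product `⨁_l A_{π l}` of realisations satisfies
  the Hodge conjecture, unconditionally (tree: nondegenerate families).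

## References

* [Gordon1999HodgeAVSurvey] B. B. Gordon, *A survey of the Hodge conjecture for abelian varieties*, §3 Theorem, 7.5–7.7,
  10.10.
* [MoonenZarhin1999LowDim] B. Moonen, Yu. Zarhin, *Hodge classes on abelian varieties of low dimension*, §3 (3.1).
* [Serre1977] J.-P. Serre, *Linear Representations of Finite Groups*, GTM 42, §2.2.
-/

set_option autoImplicit false

noncomputable section

open scoped BigOperators Classical

open CategoryTheory CategoryTheory.Limits NumberField Module IntermediateField

namespace Summit.HodgeConjecture.CorCM

open Literature.NumberTheory.ComplexMultiplication
open Literature.AlgebraicGeometry.Motives (AbelianVariety CMType)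
open Literature.AlgebraicGeometry.Motives.AbelianVariety
open Literature.AlgebraicGeometry.HodgeTheory
open Literature.AlgebraicGeometry.ComplexMultiplication (IsCMTypeRealisation)
open Literature.AlgebraicGeometry.Pohlmann1968

section Criteria

variable {I : Type} [Fintype I] {K : I → Type} [∀ i, Field (K i)] [∀ i, NumberField (K i)] [∀ i, IsCMField (K i)]
  {T₀ : Type} [Field T₀] [NumberField T₀] [IsCMField T₀] {T₁ : Type} [Field T₁] [NumberField T₁] [IsCMField T₁]

/-- **TYPE-FREE ADDITIVITY OVER (IRR) PIVOTS OF DIFFERENT DEGREES**: CM subfields `T₀ ⊆ K_{i₀}`, `T₁ ⊆ K_{i₁}` containing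
the traces (TR), with irreducible odd weights and `[T₀:ℚ] ≠ [T₁:ℚ]` ⟹ `cmFamilyRank Φ + 2 = cmTypeRank Φ₀ + cmTypeRank Φ₁ + 1`
for EVERY pair of CM types: `Hg(A₀ × A₁) = Hg(A₀) × Hg(A₁)`.
[cite: Gordon1999HodgeAVSurvey, §3 Theorem, 7.5–7.7] [cite: Serre1977, §2.2] -/
theorem cmFamilyRank_add_card_eq_of_irreducible_of_finrank_ne {i₀ i₁ : I} (h01 : i₀ ≠ i₁)
    (hI : ∀ l, l = i₀ ∨ l = i₁) (Φ : ∀ i, CMType (K i)) [Algebra T₀ (K i₀)] [Algebra T₁ (K i₁)]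
    (htr₀ : ∀ (a : K i₀ →+* ℂ) (k : K i₀), a k ∈ normalClosure ℚ (K i₁) ℂ → k ∈ Set.range (algebraMap T₀ (K i₀)))
    (htr₁ : ∀ (b : K i₁ →+* ℂ) (k : K i₁), b k ∈ normalClosure ℚ (K i₀) ℂ → k ∈ Set.range (algebraMap T₁ (K i₁)))
    (hirr₀ : ∀ W : Submodule ℚ ((T₀ →+* ℂ) → ℚ), W ≤ antiWeights (E := T₀ →+* ℂ) (starRingAut : ℂ ≃+* ℂ) → W ≠ ⊥ →
      (∀ (k : ℂ ≃+* ℂ) (f : (T₀ →+* ℂ) → ℚ), f ∈ W → (fun y => f (k • y)) ∈ W) →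
        W = antiWeights (E := T₀ →+* ℂ) (starRingAut : ℂ ≃+* ℂ))
    (hirr₁ : ∀ W : Submodule ℚ ((T₁ →+* ℂ) → ℚ), W ≤ antiWeights (E := T₁ →+* ℂ) (starRingAut : ℂ ≃+* ℂ) → W ≠ ⊥ →
      (∀ (k : ℂ ≃+* ℂ) (f : (T₁ →+* ℂ) → ℚ), f ∈ W → (fun y => f (k • y)) ∈ W) →
        W = antiWeights (E := T₁ →+* ℂ) (starRingAut : ℂ ≃+* ℂ))
    (hdeg : Module.finrank ℚ T₀ ≠ Module.finrank ℚ T₁) :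
    CMAlgebra.cmFamilyRank Φ + Fintype.card I = (∑ i, cmTypeRank (Φ i)) + 1 := by
  have hcard : Fintype.card I = 2 := by
    rw [← Finset.card_univ, show (Finset.univ : Finset I) = {i₀, i₁} from Finset.ext fun j => by
      simpa only [Finset.mem_univ, Finset.mem_insert, Finset.mem_singleton, true_iff] using hI j,
      Finset.card_pair h01]
  have hadd : cmTypeRank (Φ i₀) + cmTypeRank (Φ i₁) = CMAlgebra.cmFamilyRank Φ + 1 := by
    by_contra hne
    exact hdeg (finrank_eq_finrank_of_cmTypeRank_add_cmTypeRank_ne h01 hI Φ htr₀ htr₁ hirr₀ hirr₁ hne)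
  rw [IrrOdd.sum_eq_add_of_pair _ hI h01, hcard]
  omega

end Criteria

/-! ### Hodge side -/

section Hodge

variable {I : Type} [Fintype I] [DecidableEq I] {K : I → Type} [∀ i, Field (K i)] [∀ i, NumberField (K i)]
  [∀ i, IsCMField (K i)] {Φ : ∀ i, CMType (K i)} {A : I → AbelianVariety ℂ} {ιA : ∀ i, 𝓞 (K i) →+* End (A i)}
  {θ : ∀ i, K i →+* Module.End ℂ (complexBetti (A i).X 1)}
  {T₀ : Type} [Field T₀] [NumberField T₀] [IsCMField T₀] {T₁ : Type} [Field T₁] [NumberField T₁] [IsCMField T₁]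

omit [DecidableEq I] in
/-- **NO MIXED HODGE CLASSES over (IRR) pivots of different degrees**: every rational Hodge class on every
`A₀^a × A₁^b` (disjoint slot maps) is a `ℂ`-combination of exterior products of Hodge classes of the two factors, whatever
the CM types. [cite: MoonenZarhin1999LowDim, §3 (3.1)] [cite: Gordon1999HodgeAVSurvey, 7.5–7.7] -/
theorem forall_hodgeClassesProductSpan_of_irreducible_of_finrank_ne {i₀ i₁ : I} (h01 : i₀ ≠ i₁)
    (hI : ∀ l, l = i₀ ∨ l = i₁) [Algebra T₀ (K i₀)] [Algebra T₁ (K i₁)]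
    (htr₀ : ∀ (a : K i₀ →+* ℂ) (k : K i₀), a k ∈ normalClosure ℚ (K i₁) ℂ → k ∈ Set.range (algebraMap T₀ (K i₀)))
    (htr₁ : ∀ (b : K i₁ →+* ℂ) (k : K i₁), b k ∈ normalClosure ℚ (K i₀) ℂ → k ∈ Set.range (algebraMap T₁ (K i₁)))
    (hirr₀ : ∀ W : Submodule ℚ ((T₀ →+* ℂ) → ℚ), W ≤ antiWeights (E := T₀ →+* ℂ) (starRingAut : ℂ ≃+* ℂ) → W ≠ ⊥ →
      (∀ (k : ℂ ≃+* ℂ) (f : (T₀ →+* ℂ) → ℚ), f ∈ W → (fun y => f (k • y)) ∈ W) →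
        W = antiWeights (E := T₀ →+* ℂ) (starRingAut : ℂ ≃+* ℂ))
    (hirr₁ : ∀ W : Submodule ℚ ((T₁ →+* ℂ) → ℚ), W ≤ antiWeights (E := T₁ →+* ℂ) (starRingAut : ℂ ≃+* ℂ) → W ≠ ⊥ →
      (∀ (k : ℂ ≃+* ℂ) (f : (T₁ →+* ℂ) → ℚ), f ∈ W → (fun y => f (k • y)) ∈ W) →
        W = antiWeights (E := T₁ →+* ℂ) (starRingAut : ℂ ≃+* ℂ))
    (hdeg : Module.finrank ℚ T₀ ≠ Module.finrank ℚ T₁)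
    (hA : ∀ i, IsCMTypeRealisation (Φ i) (A i) (ιA i) (θ i)) (N₁ N₂ : ℕ) [NeZero N₁] [NeZero N₂] (π₁ : Fin N₁ → I)
    (π₂ : Fin N₂ → I) (hdisj : ∀ l₁ l₂, π₁ l₁ ≠ π₂ l₂) :
    HodgeClassesProductSpan (⨁ fun l => A (π₁ l)) (⨁ fun l => A (π₂ l)) := by
  haveI : Nonempty I := ⟨i₀⟩
  exact (cmFamilyRank_add_card_eq_iff_forall_hodgeClassesProductSpan hA).1
    (cmFamilyRank_add_card_eq_of_irreducible_of_finrank_ne h01 hI Φ htr₀ htr₁ hirr₀ hirr₁ hdeg) N₁ N₂ π₁ π₂ hdisj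

omit [DecidableEq I] in
/-- **Over (IRR) pivots of different degrees the pair is STABLY NONDEGENERATE iff both types are nondegenerate.**
[cite: Gordon1999HodgeAVSurvey, 7.5–7.6.1] -/
theorem isNondegenerateFamily_iff_of_irreducible_of_finrank_ne {i₀ i₁ : I} (h01 : i₀ ≠ i₁)
    (hI : ∀ l, l = i₀ ∨ l = i₁) (Φ : ∀ i, CMType (K i)) [Algebra T₀ (K i₀)] [Algebra T₁ (K i₁)]
    (htr₀ : ∀ (a : K i₀ →+* ℂ) (k : K i₀), a k ∈ normalClosure ℚ (K i₁) ℂ → k ∈ Set.range (algebraMap T₀ (K i₀)))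
    (htr₁ : ∀ (b : K i₁ →+* ℂ) (k : K i₁), b k ∈ normalClosure ℚ (K i₀) ℂ → k ∈ Set.range (algebraMap T₁ (K i₁)))
    (hirr₀ : ∀ W : Submodule ℚ ((T₀ →+* ℂ) → ℚ), W ≤ antiWeights (E := T₀ →+* ℂ) (starRingAut : ℂ ≃+* ℂ) → W ≠ ⊥ →
      (∀ (k : ℂ ≃+* ℂ) (f : (T₀ →+* ℂ) → ℚ), f ∈ W → (fun y => f (k • y)) ∈ W) →
        W = antiWeights (E := T₀ →+* ℂ) (starRingAut : ℂ ≃+* ℂ))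
    (hirr₁ : ∀ W : Submodule ℚ ((T₁ →+* ℂ) → ℚ), W ≤ antiWeights (E := T₁ →+* ℂ) (starRingAut : ℂ ≃+* ℂ) → W ≠ ⊥ →
      (∀ (k : ℂ ≃+* ℂ) (f : (T₁ →+* ℂ) → ℚ), f ∈ W → (fun y => f (k • y)) ∈ W) →
        W = antiWeights (E := T₁ →+* ℂ) (starRingAut : ℂ ≃+* ℂ))
    (hdeg : Module.finrank ℚ T₀ ≠ Module.finrank ℚ T₁) :
    CMAlgebra.IsNondegenerateFamily Φ ↔ ∀ i, IsNondegenerate (Φ i) := by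
  haveI : Nonempty I := ⟨i₀⟩
  exact isNondegenerateFamily_iff_forall_of_cmFamilyRank_add_card_eq Φ
    (cmFamilyRank_add_card_eq_of_irreducible_of_finrank_ne h01 hI Φ htr₀ htr₁ hirr₀ hirr₁ hdeg)

omit [DecidableEq I] in
/-- **THE HODGE CONJECTURE FOR PRODUCTS OVER (IRR) PIVOTS OF DIFFERENT DEGREES**: CM fields `K_{i₀} ⊇ T₀`, `K_{i₁} ⊇ T₁`,
CM subfields `T_κ` containing the traces with irreducible odd weights and `[T₀:ℚ] ≠ [T₁:ℚ]`, NONDEGENERATE types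
`Φ₀, Φ₁` (automatic for `T_κ = K_{i_κ}` (IRR), gen 55), realisations `A_i ⊨ (K_i; Φ_i)`: every product `⨁_l A_{π l}`
(all `A₀^a × A₁^b`) satisfies the Hodge conjecture — unconditionally, via the tree's theorem for nondegenerate families.
[cite: Gordon1999HodgeAVSurvey, 10.10 and 7.5] [cite: MoonenZarhin1999LowDim, Thm. (0.2)] -/
theorem hodgeConjectureFor_prod_of_irreducible_of_finrank_ne {i₀ i₁ : I} (h01 : i₀ ≠ i₁)
    (hI : ∀ l, l = i₀ ∨ l = i₁) [Algebra T₀ (K i₀)] [Algebra T₁ (K i₁)]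
    (htr₀ : ∀ (a : K i₀ →+* ℂ) (k : K i₀), a k ∈ normalClosure ℚ (K i₁) ℂ → k ∈ Set.range (algebraMap T₀ (K i₀)))
    (htr₁ : ∀ (b : K i₁ →+* ℂ) (k : K i₁), b k ∈ normalClosure ℚ (K i₀) ℂ → k ∈ Set.range (algebraMap T₁ (K i₁)))
    (hirr₀ : ∀ W : Submodule ℚ ((T₀ →+* ℂ) → ℚ), W ≤ antiWeights (E := T₀ →+* ℂ) (starRingAut : ℂ ≃+* ℂ) → W ≠ ⊥ →
      (∀ (k : ℂ ≃+* ℂ) (f : (T₀ →+* ℂ) → ℚ), f ∈ W → (fun y => f (k • y)) ∈ W) →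
        W = antiWeights (E := T₀ →+* ℂ) (starRingAut : ℂ ≃+* ℂ))
    (hirr₁ : ∀ W : Submodule ℚ ((T₁ →+* ℂ) → ℚ), W ≤ antiWeights (E := T₁ →+* ℂ) (starRingAut : ℂ ≃+* ℂ) → W ≠ ⊥ →
      (∀ (k : ℂ ≃+* ℂ) (f : (T₁ →+* ℂ) → ℚ), f ∈ W → (fun y => f (k • y)) ∈ W) →
        W = antiWeights (E := T₁ →+* ℂ) (starRingAut : ℂ ≃+* ℂ))
    (hdeg : Module.finrank ℚ T₀ ≠ Module.finrank ℚ T₁) (hnd : ∀ i, IsNondegenerate (Φ i))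
    (hA : ∀ i, IsCMTypeRealisation (Φ i) (A i) (ιA i) (θ i)) {N : ℕ} (π : Fin N → I) :
    HodgeConjectureFor (⨁ fun l : Fin N => A (π l)).dim (⨁ fun l : Fin N => A (π l)).X := by
  haveI : Nonempty I := ⟨i₀⟩
  exact ((isNondegenerateFamily_iff_of_irreducible_of_finrank_ne h01 hI Φ htr₀ htr₁ hirr₀ hirr₁ hdeg).2
    hnd).hodgeConjectureFor_prod hA π

end Hodge

end Summit.HodgeConjecture.CorCM

end
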